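import Mathlib.Topology.Algebra.InfiniteSum.Real
import Mathlib.Topology.Algebra.InfiniteSum.Constructions
import Mathlib.Analysis.Normed.Group.InfiniteSum
import Mathlib.Analysis.Normed.Group.FunctionSeries
import Mathlib.Analysis.SpecificLimits.Basic
import Mathlib.LinearAlgebra.Basis.VectorSpace
import Mathlib.Tactic.Linarith
import Mathlib.Tactic.Positivity
import Mathlib.Tactic.Ring
import HarnessLib

/-!
# Taylor germs of functions of `(z, z̄)` at a point, and the Taylor-coefficient functional
(cell `pub-ising3x`, seat boot-1; gate (g0) of the M3-γ milestone — DERIVATIVE functionals as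
honest `CrossingFunctional`s — part 1: the function-space side, no conformal input)

HONEST FRAMING: lottery ticket; floor = tightest certified 3D Ising CFT bounds; no exact-solution
claim without a proof.

The tree's dual argument (`…ConformalBootstrap3D.DualFunctional`: `CrossingFunctional`,
`AppliesTermwise`) needs every `αⁱ` to be LINEAR ON ALL functions `ℝ → ℝ → ℝ`; a derivative
functional written with `deriv` is not (junk values). Linear version WITHOUT differential calculus:
* `HasTaylorGerm F x₀ y₀ r T` — on the open square of half-width `r` around `(x₀, y₀)`,
  `F(x₀+h, y₀+k) = ∑_{(a,b)} T_{ab} h^a k^b` absolutely (`T_{ab} = ∂_z^a ∂_z̄^b F(x₀,y₀)/(a! b!)`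
  classically; the factorials are a normalisation a certificate absorbs); algebra of germs;
* UNIQUENESS `HasTaylorGerm.unique` (identity theorem for absolutely convergent real double power
  series: least non-zero coefficient + `continuousOn_tsum`, one variable at a time);
* `germSubmodule x₀ y₀` and `taylorCoeff x₀ y₀ : (ℝ → ℝ → ℝ) →ₗ[ℝ] (ℕ × ℕ → ℝ)`, a linear extension
  (`LinearMap.exists_extend`; values off the subspace unspecified and never used) of the honest
  coefficient map, computation rule `taylorCoeff_eq`, components `taylorCoeffAt x₀ y₀ (a,b)`.
Part 2 (`TaylorFunctional.lean`): `CrossingFunctional`s from `taylorCoeffAt` and termwise action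
(M-test on germs); part 3: germs and majorants of the conformal-block terms. (pub-ising3d
`T4A-DESIGN.md` proposed the `ContDiffOn`/`iteratedFDeriv` route; the germ route needs no Fréchet
calculus and matches the tree's `IsDoublePowerSeriesOn`.) Sources: elementary real analysis only.
-/

namespace Summit.CriticalPhenomena.Ising3D

open Set Filter Topology

/-! ### Germs -/

/-- `HasTaylorGerm F x₀ y₀ r T`: `r > 0` and for all `|h|, |k| < r` the double family
`T_{ab} h^a k^b` is absolutely summable with sum `F (x₀ + h) (y₀ + k)` — the Taylor expansion of
`F` at `(x₀, y₀)` with coefficient array `T : ℕ × ℕ → ℝ` (`T (a,b)` = coefficient of `h^a k^b`).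
[folklore] -/
def HasTaylorGerm (F : ℝ → ℝ → ℝ) (x₀ y₀ r : ℝ) (T : ℕ × ℕ → ℝ) : Prop :=
  0 < r ∧ ∀ h k : ℝ, |h| < r → |k| < r →
    Summable (fun p : ℕ × ℕ => |T p| * |h| ^ p.1 * |k| ^ p.2) ∧
      HasSum (fun p : ℕ × ℕ => T p * h ^ p.1 * k ^ p.2) (F (x₀ + h) (y₀ + k))

namespace HasTaylorGerm

variable {F G : ℝ → ℝ → ℝ} {x₀ y₀ r r' : ℝ} {T U : ℕ × ℕ → ℝ}

/-- The radius of a germ is positive. [folklore] -/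
theorem pos (hF : HasTaylorGerm F x₀ y₀ r T) : 0 < r := hF.1

/-- Absolute summability of the expansion inside the square. [folklore] -/
theorem summable_abs (hF : HasTaylorGerm F x₀ y₀ r T) {h k : ℝ} (hh : |h| < r) (hk : |k| < r) :
    Summable (fun p : ℕ × ℕ => |T p| * |h| ^ p.1 * |k| ^ p.2) :=
  (hF.2 h k hh hk).1

/-- The expansion sums to the value of the function. [folklore] -/
theorem hasSum (hF : HasTaylorGerm F x₀ y₀ r T) {h k : ℝ} (hh : |h| < r) (hk : |k| < r) :
    HasSum (fun p : ℕ × ℕ => T p * h ^ p.1 * k ^ p.2) (F (x₀ + h) (y₀ + k)) :=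
  (hF.2 h k hh hk).2

/-- The expansion is summable (from absolute summability). [folklore] -/
theorem summable (hF : HasTaylorGerm F x₀ y₀ r T) {h k : ℝ} (hh : |h| < r) (hk : |k| < r) :
    Summable (fun p : ℕ × ℕ => T p * h ^ p.1 * k ^ p.2) :=
  (hF.hasSum hh hk).summable

/-- `tsum` form of the expansion. [folklore] -/
theorem tsum_eq (hF : HasTaylorGerm F x₀ y₀ r T) {h k : ℝ} (hh : |h| < r) (hk : |k| < r) :
    ∑' p : ℕ × ℕ, T p * h ^ p.1 * k ^ p.2 = F (x₀ + h) (y₀ + k) :=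
  (hF.hasSum hh hk).tsum_eq

/-- Shrinking the radius. [folklore] -/
theorem mono (hF : HasTaylorGerm F x₀ y₀ r T) (hr' : 0 < r') (hle : r' ≤ r) :
    HasTaylorGerm F x₀ y₀ r' T :=
  ⟨hr', fun h k hh hk => hF.2 h k (lt_of_lt_of_le hh hle) (lt_of_lt_of_le hk hle)⟩

/-- A germ only sees the values on the square: functions agreeing there share it. [folklore] -/
theorem congr (hF : HasTaylorGerm F x₀ y₀ r T)
    (hFG : ∀ h k : ℝ, |h| < r → |k| < r → F (x₀ + h) (y₀ + k) = G (x₀ + h) (y₀ + k)) :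
    HasTaylorGerm G x₀ y₀ r T :=
  ⟨hF.1, fun h k hh hk => ⟨hF.summable_abs hh hk, hFG h k hh hk ▸ hF.hasSum hh hk⟩⟩

/-- Sum of germs. [folklore] -/
theorem add (hF : HasTaylorGerm F x₀ y₀ r T) (hG : HasTaylorGerm G x₀ y₀ r U) :
    HasTaylorGerm (F + G) x₀ y₀ r (T + U) := by
  refine ⟨hF.1, fun h k hh hk => ⟨?_, ?_⟩⟩
  · refine ((hF.summable_abs hh hk).add (hG.summable_abs hh hk)).of_nonneg_of_le
      (fun p => by positivity) (fun p => ?_)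
    have habs : |T p + U p| ≤ |T p| + |U p| := abs_add_le _ _
    have hnn : 0 ≤ |h| ^ p.1 * |k| ^ p.2 := by positivity
    calc |(T + U) p| * |h| ^ p.1 * |k| ^ p.2 = |T p + U p| * (|h| ^ p.1 * |k| ^ p.2) := by
          simp only [Pi.add_apply, mul_assoc]
      _ ≤ (|T p| + |U p|) * (|h| ^ p.1 * |k| ^ p.2) := mul_le_mul_of_nonneg_right habs hnn
      _ = _ := by ring
  · have hs := (hF.hasSum hh hk).add (hG.hasSum hh hk)
    refine hs.congr_fun fun p => ?_
    simp only [Pi.add_apply]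
    ring

/-- Scalar multiple of a germ. [folklore] -/
theorem smul (hF : HasTaylorGerm F x₀ y₀ r T) (c : ℝ) :
    HasTaylorGerm (c • F) x₀ y₀ r (c • T) := by
  refine ⟨hF.1, fun h k hh hk => ⟨?_, ?_⟩⟩
  · refine ((hF.summable_abs hh hk).mul_left |c|).congr fun p => ?_
    simp only [Pi.smul_apply, smul_eq_mul, abs_mul]
    ring
  · have hs := (hF.hasSum hh hk).mul_left c
    refine hs.congr_fun fun p => ?_
    simp only [Pi.smul_apply, smul_eq_mul]
    ring

/-- Negative of a germ. [folklore] -/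
theorem neg (hF : HasTaylorGerm F x₀ y₀ r T) : HasTaylorGerm (-F) x₀ y₀ r (-T) := by
  simpa only [neg_one_smul] using hF.smul (-1)

/-- Difference of germs. [folklore] -/
theorem sub (hF : HasTaylorGerm F x₀ y₀ r T) (hG : HasTaylorGerm G x₀ y₀ r U) :
    HasTaylorGerm (F - G) x₀ y₀ r (T - U) := by
  simpa only [← sub_eq_add_neg] using hF.add hG.neg

end HasTaylorGerm

/-- The coefficient array of a constant: `c` at `(0,0)`, zero elsewhere. [folklore] -/
def constGerm (c : ℝ) (p : ℕ × ℕ) : ℝ := if p = (0, 0) then c else 0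

/-- A constant function has the constant germ, at every point and radius. [folklore] -/
theorem hasTaylorGerm_const (c x₀ y₀ : ℝ) {r : ℝ} (hr : 0 < r) :
    HasTaylorGerm (fun _ _ => c) x₀ y₀ r (constGerm c) := by
  refine ⟨hr, fun h k _ _ => ⟨?_, ?_⟩⟩
  · refine summable_of_ne_finset_zero (s := {(0, 0)}) fun p hp => ?_
    have hp' : p ≠ (0, 0) := by simpa using hp
    simp [constGerm, hp']
  · have := hasSum_single (f := fun p : ℕ × ℕ => constGerm c p * h ^ p.1 * k ^ p.2) (0, 0)
      (fun p hp => by simp [constGerm, hp])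
    simpa [constGerm] using this

/-- The zero function has the zero germ. [folklore] -/
theorem hasTaylorGerm_zero (x₀ y₀ : ℝ) {r : ℝ} (hr : 0 < r) :
    HasTaylorGerm (0 : ℝ → ℝ → ℝ) x₀ y₀ r 0 := by
  have h0 : constGerm 0 = 0 := funext fun p => by simp [constGerm]
  exact h0 ▸ hasTaylorGerm_const 0 x₀ y₀ hr

/-! ### Uniqueness of the coefficient array -/

/-- One variable: if `∑_n a_n x^n` converges absolutely and sums to `0` for every `0 < x < ρ`,
then `a = 0` (least non-zero coefficient + continuity of the shifted series at `0`).
[folklore] -/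
theorem eq_zero_of_hasSum_pow_eq_zero (a : ℕ → ℝ) {ρ : ℝ} (hρ : 0 < ρ)
    (hs : ∀ x : ℝ, 0 < x → x < ρ → Summable (fun n => |a n| * x ^ n))
    (h0 : ∀ x : ℝ, 0 < x → x < ρ → HasSum (fun n => a n * x ^ n) 0) : a = 0 := by
  by_contra hne
  have hex : ∃ n, a n ≠ 0 := by
    by_contra hall
    exact hne (funext fun n => not_not.mp (not_exists.mp hall n))
  classical
  let N := Nat.find hex
  have hN : a N ≠ 0 := Nat.find_spec hex
  have hlt : ∀ n < N, a n = 0 := fun n hn => by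
    have := Nat.find_min hex hn
    simpa using this
  -- the shifted series `g x = ∑_m a (m+N) x^m` vanishes on `(0, ρ)`
  set g : ℝ → ℝ := fun x => ∑' m, a (m + N) * x ^ m with hg
  have hshift : ∀ x : ℝ, 0 < x → x < ρ → HasSum (fun m => a (m + N) * x ^ m) 0 := by
    intro x hx hxρ
    have h1 := (hasSum_nat_add_iff' N).mpr (h0 x hx hxρ)
    have hfin : ∑ i ∈ Finset.range N, a i * x ^ i = 0 :=
      Finset.sum_eq_zero fun i hi => by rw [hlt i (Finset.mem_range.mp hi), zero_mul]
    rw [hfin, sub_zero] at h1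
    have hxN : x ^ N ≠ 0 := pow_ne_zero _ hx.ne'
    have h2 := h1.mul_left ((x ^ N)⁻¹)
    rw [mul_zero] at h2
    refine h2.congr_fun fun m => ?_
    rw [pow_add]
    field_simp
  have hgzero : ∀ x : ℝ, 0 < x → x < ρ → g x = 0 := fun x hx hxρ => (hshift x hx hxρ).tsum_eq
  -- `g` is continuous on `[0, ρ/2]`
  have hρ2 : 0 < ρ / 2 := by linarith
  have hsum2 : Summable (fun m => |a (m + N)| * (ρ / 2) ^ m) := by
    have h1 := (summable_nat_add_iff (f := fun n => |a n| * (ρ / 2) ^ n) N).mpr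
      (hs (ρ / 2) hρ2 (by linarith))
    have hρN : (ρ / 2) ^ N ≠ 0 := pow_ne_zero _ hρ2.ne'
    refine (h1.mul_left (((ρ / 2) ^ N)⁻¹)).congr fun m => ?_
    simp only [pow_add]
    field_simp
  have hcont : ContinuousOn g (Icc 0 (ρ / 2)) := by
    refine continuousOn_tsum (u := fun m => |a (m + N)| * (ρ / 2) ^ m)
      (fun m => ((continuous_const.mul (continuous_pow m)).continuousOn)) hsum2 ?_
    intro m x hx
    rw [Real.norm_eq_abs, abs_mul, abs_pow, abs_of_nonneg hx.1]
    exact mul_le_mul_of_nonneg_left (pow_le_pow_left₀ hx.1 hx.2 m) (abs_nonneg _)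
  -- value at `0`
  have hg0 : g 0 = a N := by
    simp only [hg]
    rw [tsum_eq_single 0]
    · simp
    · intro m hm
      simp [hm]
  -- limit along `(0, ρ/2)`
  have hmem : (0 : ℝ) ∈ closure (Ioo 0 (ρ / 2)) := by
    rw [closure_Ioo hρ2.ne]
    exact ⟨le_rfl, hρ2.le⟩
  haveI : (𝓝[Ioo 0 (ρ / 2)] (0 : ℝ)).NeBot := mem_closure_iff_nhdsWithin_neBot.mp hmem
  have hT1 : Tendsto g (𝓝[Ioo 0 (ρ / 2)] 0) (𝓝 (g 0)) :=
    ((hcont 0 ⟨le_rfl, hρ2.le⟩).tendsto).mono_left (nhdsWithin_mono _ Ioo_subset_Icc_self)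
  have hT2 : Tendsto g (𝓝[Ioo 0 (ρ / 2)] 0) (𝓝 0) := by
    refine (tendsto_const_nhds (x := (0 : ℝ))).congr' ?_
    filter_upwards [self_mem_nhdsWithin] with x hx
    exact (hgzero x hx.1 (by linarith [hx.2])).symm
  have := tendsto_nhds_unique hT1 hT2
  rw [hg0] at this
  exact hN this

namespace HasTaylorGerm

variable {F : ℝ → ℝ → ℝ} {x₀ y₀ r : ℝ} {T : ℕ × ℕ → ℝ}

/-- The germ of a function vanishing on the (positive quadrant of the) square is zero: the
two-variable identity theorem, by rows then columns. [folklore] -/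
theorem eq_zero_of_eq_zero (hF : HasTaylorGerm F x₀ y₀ r T)
    (h0 : ∀ h k : ℝ, 0 < h → h < r → 0 < k → k < r → F (x₀ + h) (y₀ + k) = 0) : T = 0 := by
  have hr := hF.pos
  -- Step 1: for fixed `0 < k < r`, the row sums `c a = ∑_b T(a,b) k^b` vanish for every `a`.
  have hrow : ∀ k : ℝ, 0 < k → k < r → (fun a => ∑' b, T (a, b) * k ^ b) = 0 := by
    intro k hk hkr
    have hk' : |k| < r := by rwa [abs_of_pos hk]
    refine eq_zero_of_hasSum_pow_eq_zero _ hr (fun x hx hxr => ?_) (fun x hx hxr => ?_)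
    · have hx' : |x| < r := by rwa [abs_of_pos hx]
      have hS := hF.summable_abs hx' hk'
      -- row sums of the absolute family
      have hS1 : Summable fun a => ∑' b, |T (a, b)| * |x| ^ a * |k| ^ b := hS.prod
      refine hS1.of_nonneg_of_le (fun a => by positivity) fun a => ?_
      have hfa : Summable fun b => |T (a, b)| * |x| ^ a * |k| ^ b := hS.prod_factor a
      have hsb : Summable fun b => |T (a, b)| * |k| ^ b := by
        have hc : |x| ^ a ≠ 0 := pow_ne_zero _ (by rw [abs_of_pos hx]; exact hx.ne')
        refine ((hfa.mul_left ((|x| ^ a)⁻¹))).congr fun b => ?_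
        field_simp
      have h1 : |∑' b, T (a, b) * k ^ b| ≤ ∑' b, |T (a, b)| * |k| ^ b := by
        have hn : Summable fun b => ‖T (a, b) * k ^ b‖ := by
          simpa [Real.norm_eq_abs, abs_mul, abs_pow] using hsb
        have := norm_tsum_le_tsum_norm hn
        simpa [Real.norm_eq_abs, abs_mul, abs_pow] using this
      calc |∑' b, T (a, b) * k ^ b| * x ^ a ≤ (∑' b, |T (a, b)| * |k| ^ b) * x ^ a :=
            mul_le_mul_of_nonneg_right h1 (pow_nonneg hx.le _)
        _ = ∑' b, |T (a, b)| * |x| ^ a * |k| ^ b := by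
            rw [← tsum_mul_right, abs_of_pos hx]
            exact tsum_congr fun b => by ring
    · have hx' : |x| < r := by rwa [abs_of_pos hx]
      have hsum := hF.hasSum hx' hk'
      rw [h0 x k hx hxr hk hkr] at hsum
      have hfib : ∀ a, HasSum (fun b => T (a, b) * x ^ a * k ^ b) ((∑' b, T (a, b) * k ^ b) * x ^ a) := by
        intro a
        have hfa : Summable fun b => T (a, b) * x ^ a * k ^ b := (hF.summable hx' hk').prod_factor a
        have := hfa.hasSum
        rw [show ∑' b, T (a, b) * x ^ a * k ^ b = (∑' b, T (a, b) * k ^ b) * x ^ a by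
          rw [← tsum_mul_right]; exact tsum_congr fun b => by ring] at this
        exact this
      exact hsum.prod_fiberwise hfib
  -- Step 2: for fixed `a`, `b ↦ T(a,b)` is a one-variable series vanishing on `(0, r)`.
  funext p
  obtain ⟨a, b⟩ := p
  have hcol : (fun b => T (a, b)) = 0 := by
    refine eq_zero_of_hasSum_pow_eq_zero _ hr (fun k hk hkr => ?_) (fun k hk hkr => ?_)
    · have hk' : |k| < r := by rwa [abs_of_pos hk]
      have hr2 : |r / 2| < r := by rw [abs_of_pos (by linarith)]; linarith
      have hS := (hF.summable_abs hr2 hk').prod_factor a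
      have hc : (|r / 2| ^ a) ≠ 0 := pow_ne_zero _ (by rw [abs_of_pos (by linarith)]; linarith)
      refine ((hS.mul_left ((|r / 2| ^ a)⁻¹))).congr fun b => ?_
      rw [abs_of_pos hk]
      field_simp
    · have hk' : |k| < r := by rwa [abs_of_pos hk]
      have hr2' : (0 : ℝ) < r / 2 := by linarith
      have hr2 : |r / 2| < r := by rw [abs_of_pos hr2']; linarith
      have hfa : Summable fun b => T (a, b) * (r / 2) ^ a * k ^ b :=
        (hF.summable hr2 hk').prod_factor a
      have hval : ∑' b, T (a, b) * k ^ b = 0 := by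
        have := congrFun (hrow k hk hkr) a
        simpa using this
      have hsb : Summable fun b => T (a, b) * k ^ b := by
        refine (hfa.mul_left (((r / 2) ^ a)⁻¹)).congr fun b => ?_
        have hc : ((r / 2) ^ a) ≠ 0 := pow_ne_zero _ hr2'.ne'
        field_simp
      rw [← hval]
      exact hsb.hasSum
  exact congrFun hcol b

/-- **Uniqueness of the Taylor germ**: two germs of the same function at the same point (any
radii) have the same coefficient array. [folklore] -/
theorem unique {r₁ r₂ : ℝ} {T₁ T₂ : ℕ × ℕ → ℝ} (h₁ : HasTaylorGerm F x₀ y₀ r₁ T₁)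
    (h₂ : HasTaylorGerm F x₀ y₀ r₂ T₂) : T₁ = T₂ := by
  have hm₁ := h₁.mono (lt_min h₁.pos h₂.pos) (min_le_left _ _)
  have hm₂ := h₂.mono (lt_min h₁.pos h₂.pos) (min_le_right _ _)
  have hd := hm₁.sub hm₂
  have hz : T₁ - T₂ = 0 := hd.eq_zero_of_eq_zero fun h k _ _ _ _ => by simp
  exact sub_eq_zero.mp hz

end HasTaylorGerm

/-! ### The Taylor-coefficient functional -/

/-- The functions `ℝ → ℝ → ℝ` admitting a Taylor germ at `(x₀, y₀)` form a subspace. [folklore] -/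
def germSubmodule (x₀ y₀ : ℝ) : Submodule ℝ (ℝ → ℝ → ℝ) where
  carrier := {F | ∃ (r : ℝ) (T : ℕ × ℕ → ℝ), HasTaylorGerm F x₀ y₀ r T}
  add_mem' := by
    rintro F G ⟨r₁, T₁, h₁⟩ ⟨r₂, T₂, h₂⟩
    exact ⟨min r₁ r₂, T₁ + T₂, (h₁.mono (lt_min h₁.pos h₂.pos) (min_le_left _ _)).add
      (h₂.mono (lt_min h₁.pos h₂.pos) (min_le_right _ _))⟩
  zero_mem' := ⟨1, 0, hasTaylorGerm_zero x₀ y₀ one_pos⟩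
  smul_mem' := by
    rintro c F ⟨r, T, h⟩
    exact ⟨r, c • T, h.smul c⟩

/-- Membership in `germSubmodule`, unfolded. [folklore] -/
theorem mem_germSubmodule {x₀ y₀ : ℝ} {F : ℝ → ℝ → ℝ} :
    F ∈ germSubmodule x₀ y₀ ↔ ∃ (r : ℝ) (T : ℕ × ℕ → ℝ), HasTaylorGerm F x₀ y₀ r T := Iff.rfl

/-- The honest coefficient map on the subspace: the (unique) coefficient array of a chosen germ.
[folklore] -/
noncomputable def germCoeff (x₀ y₀ : ℝ) (F : germSubmodule x₀ y₀) : ℕ × ℕ → ℝ :=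
  Classical.choose (Classical.choose_spec F.2)

/-- `germCoeff` returns THE coefficient array of any germ of the function. [folklore] -/
theorem germCoeff_eq {x₀ y₀ : ℝ} (F : germSubmodule x₀ y₀) {r : ℝ} {T : ℕ × ℕ → ℝ}
    (hF : HasTaylorGerm (F : ℝ → ℝ → ℝ) x₀ y₀ r T) : germCoeff x₀ y₀ F = T :=
  (Classical.choose_spec (Classical.choose_spec F.2)).unique hF

/-- The coefficient map is linear on the subspace (by uniqueness of germs). [folklore] -/
noncomputable def germCoeffₗ (x₀ y₀ : ℝ) : germSubmodule x₀ y₀ →ₗ[ℝ] (ℕ × ℕ → ℝ) where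
  toFun := germCoeff x₀ y₀
  map_add' := by
    intro F G
    obtain ⟨r₁, T₁, h₁⟩ := F.2
    obtain ⟨r₂, T₂, h₂⟩ := G.2
    have hs : HasTaylorGerm ((F + G : germSubmodule x₀ y₀) : ℝ → ℝ → ℝ) x₀ y₀ (min r₁ r₂) (T₁ + T₂) :=
      (h₁.mono (lt_min h₁.pos h₂.pos) (min_le_left _ _)).add
        (h₂.mono (lt_min h₁.pos h₂.pos) (min_le_right _ _))
    rw [germCoeff_eq _ hs, germCoeff_eq F h₁, germCoeff_eq G h₂]
  map_smul' := by
    intro c F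
    obtain ⟨r, T, h⟩ := F.2
    have hs : HasTaylorGerm ((c • F : germSubmodule x₀ y₀) : ℝ → ℝ → ℝ) x₀ y₀ r (c • T) := h.smul c
    rw [germCoeff_eq _ hs, germCoeff_eq F h, RingHom.id_apply]

/-- **The Taylor-coefficient functional** at `(x₀, y₀)`: a linear map on ALL functions
`ℝ → ℝ → ℝ` with values in coefficient arrays, extending the honest coefficient map of
`germSubmodule x₀ y₀` (`LinearMap.exists_extend`; the values off the subspace are unspecified and
never used). [folklore] -/
noncomputable def taylorCoeff (x₀ y₀ : ℝ) : (ℝ → ℝ → ℝ) →ₗ[ℝ] (ℕ × ℕ → ℝ) :=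
  Classical.choose (LinearMap.exists_extend (germCoeffₗ x₀ y₀))

/-- The extension property of `taylorCoeff`. [folklore] -/
theorem taylorCoeff_comp_subtype (x₀ y₀ : ℝ) :
    (taylorCoeff x₀ y₀).comp (germSubmodule x₀ y₀).subtype = germCoeffₗ x₀ y₀ :=
  Classical.choose_spec (LinearMap.exists_extend (germCoeffₗ x₀ y₀))

/-- **Computation rule**: on a function with a germ, `taylorCoeff` IS its coefficient array.
[folklore] -/
theorem taylorCoeff_eq {x₀ y₀ : ℝ} {F : ℝ → ℝ → ℝ} {r : ℝ} {T : ℕ × ℕ → ℝ}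
    (hF : HasTaylorGerm F x₀ y₀ r T) : taylorCoeff x₀ y₀ F = T := by
  have hmem : F ∈ germSubmodule x₀ y₀ := ⟨r, T, hF⟩
  have h := LinearMap.congr_fun (taylorCoeff_comp_subtype x₀ y₀) ⟨F, hmem⟩
  simp only [LinearMap.coe_comp, Function.comp_apply, Submodule.coe_subtype] at h
  rw [h]
  exact germCoeff_eq ⟨F, hmem⟩ hF

/-- The `(a,b)` Taylor coefficient at `(x₀, y₀)` as a real-linear functional on all functions
(`= ∂_z^a ∂_z̄^b F(x₀,y₀)/(a! b!)` on functions with a germ). [folklore] -/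
noncomputable def taylorCoeffAt (x₀ y₀ : ℝ) (p : ℕ × ℕ) : (ℝ → ℝ → ℝ) →ₗ[ℝ] ℝ :=
  (LinearMap.proj p).comp (taylorCoeff x₀ y₀)

/-- `taylorCoeffAt` unfolded. [folklore] -/
theorem taylorCoeffAt_apply (x₀ y₀ : ℝ) (p : ℕ × ℕ) (F : ℝ → ℝ → ℝ) :
    taylorCoeffAt x₀ y₀ p F = taylorCoeff x₀ y₀ F p := rfl

/-- **Computation rule** for the components. [folklore] -/
theorem taylorCoeffAt_eq {x₀ y₀ : ℝ} {F : ℝ → ℝ → ℝ} {r : ℝ} {T : ℕ × ℕ → ℝ}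
    (hF : HasTaylorGerm F x₀ y₀ r T) (p : ℕ × ℕ) : taylorCoeffAt x₀ y₀ p F = T p := by
  rw [taylorCoeffAt_apply, taylorCoeff_eq hF]

/-- A function vanishing on the square around `(x₀, y₀)` of some half-width has all Taylor
coefficients `0` there (it has the zero germ). [folklore] -/
theorem taylorCoeff_eq_zero_of_eqOn {x₀ y₀ r : ℝ} (hr : 0 < r) {F : ℝ → ℝ → ℝ}
    (h0 : ∀ h k : ℝ, |h| < r → |k| < r → F (x₀ + h) (y₀ + k) = 0) : taylorCoeff x₀ y₀ F = 0 := by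
  have hz := (hasTaylorGerm_zero x₀ y₀ hr).congr (G := F) fun h k hh hk => by
    simp [h0 h k hh hk]
  exact taylorCoeff_eq hz

end Summit.CriticalPhenomena.Ising3D
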